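import Mathlib
import HarnessLib
import HarnessLib.Audit
import Summits.HodgeConjecture.HodgeConjecture.Theses.KleimanBFSeeds
import Summits.HodgeConjecture.HodgeConjecture.Theses.DoublyPolarisedTransport
import Summits.HodgeConjecture.HodgeConjecture.Theorems.DoublyPolarisedSimilarAnchorsOfTwistedCube
import Summits.HodgeConjecture.HodgeConjecture.Theorems.KleimanBFSeedsWeilSimilarTrans
import Summits.HodgeConjecture.HodgeConjecture.Theorems.KleimanBFSeedsKleimanSemiregularAnchorReductions
import Summits.HodgeConjecture.HodgeConjecture.Theorems.Ring2AbelianAllWeilSimilarDiscriminant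
import Literature.AlgebraicGeometry.Motives.WeilSimilar
import Literature.AlgebraicGeometry.HodgeTheory.WeilClassesBFSheafSeedAt
import Literature.AlgebraicGeometry.HodgeTheory.ChernCharacterBettiTwistNormalised
import Literature.AlgebraicGeometry.HodgeTheory.SemiregularVariationalHodgeISemiregularCoherent
import Literature.AlgebraicGeometry.HodgeTheory.HomComplexSigmaDinatural
import Literature.AlgebraicGeometry.HodgeTheory.HomComplexSigmaWindow

/-!
# Skeleton `Lines/fibre_exchange_classes` for the crux `TwistNormalisedKleimanSemiregularAnchorR` (K2ᵀᴿ, item 27388)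
# — the E♯ FIBRE-EXCHANGE line at the NATIVE discriminant `d = 12`, composed with `central-character-transfer`
# (line card: `Lines/fibre_exchange_classes.md`; idea cards `Ideas/fibre-exchange-classes.md`, `Ideas/central-character-transfer.md`)

HONEST FRAMING: a crux PROOF SKELETON (cruxes-workfile class, CRUX-PLAN shape), not a proof. HC is NOT proved. Exactly SIX
`sorry`s, all inside the six declared stubs: this line's OWN stub `stub_exchange_d12` (NEW, load-bearing here), the sibling
line's two `d = 3` stubs `stub_halfDescentInput_d3`, `stub_fibreTransfer_d3` (CARRIED VERBATIM — same name, same statement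
text, with verbatim copies of their definitions — from the registered skeleton `Lines/lagrangian_half_descent_anchor.lean`,
sha 14179b62164a, so that registering THIS skeleton (one active skeleton record per crux) expires none of them), and the three
chosen-anchor records `stub_good`, `stub_rung_CMclass_d12`, `stub_rung_CMclass_d3` (carried verbatim, as the sibling did).
Everything else is PROVED from tree theorems; typed ≠ proved, registered ≠ closed. Nothing here proves K2ᵀᴿ, any rung,
K2ᵀ (28148), `WeilSixfolds`, HC_AV, HC_CM or HC. Planning is bookkeeping.

PROVENANCE: unit `cruxplan-27388-fibre-exchange-classes` g0 (director-hodge g33 req-210 (A2), operator priority31a∕32a,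
2026-08-31): «compose the fibre-exchange T-sieve with `central-character-transfer` as its transfer stub into ONE line on E♯,
NATIVE `d = 12` (matches the registered first-rung candidate `stub_rung_CMclass_d12`); if the composition cannot carry both,
say so». Triage: `TRIAGE-r1-1.md`, `TRIAGE-r1-2.md` (both ideas pass; sharpenings answered in the line card).

## THE LINE IN ONE PARAGRAPH

At a doubly-polarised `(3, 12)` anchor `P` of a non-split cell `δ` — hyperbolic at `h′ = h(e′,a′)` (so Markman's secant
sheaf E♯ of the hyperbolic `ℚ(√−3)` cell, native `ψ₀² = −12`, lives on `P` and is a COHERENT BF SEED IN THE FRAME `h′`: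
`(σ_q)`-semiregular on a strictly perfect resolution, `ch₃ = q′h′³ + N′w`, `N′ ≠ 0`) and of discriminant class `δ` at
`h = h(e,a)` — EXCHANGE E♯ along parallel fibres of the isotrivial fibration of the anchor into a sub-object `E′ → E♯`
(a chain map `φ : R′• ⟶ R_F•` of strictly perfect resolutions) whose Chern character is RE-FRAMED into `ℚ[h] ⊕ ℚ·w`
(`ch₃(E′) = q h³ + N w`, `N ≠ 0`; the R♮ ∕ repointing class identity), and TRANSFER semiregularity from E♯ to E′ by the
two rows of `central-character-transfer` read on the `σ`-side through Buchweitz–Flenner DINATURALITY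
`σ^{E′}(φ^* y) = σ^{E♯}(φ_* y)` ([BF03, Cor. 4.8], tree `HomComplex.sigmaC_dinatural`): LOCALITY (`σ`-invisible classes of
`E′` come from `Ext²(E♯, E′)`) and flat VISIBILITY (`ker φ_* ⊆ ker φ^*`). The transfer is PROVED here
(`isISemiregularC_of_locality_of_visibility`, sorry-free, for any chain map of strictly perfect complexes — no surjectivity
of `φ^*`, the version LEMMA S∕J + B2′ killed); the geometric package is the ONE existential stub `stub_exchange_d12`; the
rest is the chosen-anchor reduction (pointwise Landherr, PROVED; copied verbatim in §1 because the module
`…Lines.chosen_anchor` is not yet built on the farm — an import variant of this file is attached as evidence).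

WHY ONE EXISTENTIAL STUB (not INPUT ∕ EXCHANGE ∕ LOCALITY ∕ VISIBILITY as four): the rows are properties of the SAME
un-named objects `(P, E♯, E′, φ)`; split into separate theorems they either stop sharing witnesses or become universal
claims («every semiregular `F` admits a good exchange») that are false-or-circular for silly `F` (`F = 𝒪_P` is
`{0}`-semiregular; a re-framed semiregular `E′ ⊂ 𝒪_P` would be the ideal sheaf of a Weil cycle). The frame rows on the
input (`ch(E♯) ∈ ℚ[h′] ⊕ ℚ·w`, `N′ ≠ 0`) are what keep the stub from degenerating to `φ = 𝟙` (a direct `h`-frame seed),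
i.e. what makes it the E♯ line and not the `d = 12` seed clause in costume.

WHAT THE COMPOSITION CARRIES (director's question): the TRANSFER stub of `central-character-transfer` is carried TYPED and
PROVED (rows `SigmaLocality`, `VisibilityFlat` + the transfer lemma); the fibre-exchange T-SIEVE `T(Q₁, ε): α ∪ ε = 0 ∈
Ext²_Y(Q₁, K) ∀ α ∈ H¹(Y, 𝒪_Y)` is carried UNTYPED, as the necessary condition ∕ kill path of the LOCALITY row (the tree
has no `H¹(𝒪)`-cup on `Ext` of a pair of bundles on the fibre `Y`; typing it is a definition request recorded in the card),
so NO third crux-plan seat is needed for the transfer; a typer seat would be needed only to make `T` a Lean row.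

SCOPE (honest): this line reaches the rung `KleimanAnchorRungCMR 12` (`kleimanAnchorRungCMR_twelve`, sorry-cone =
`stub_exchange_d12` only) — NOT every `d`; the crux BY NAME is concluded, as in both registered skeletons, from `stub_good`
(`TwistNormalisedKleimanSemiregularAnchorR_of`). `stub_rung_CMclass_d12` is kept as a record; this file discharges it
through `kleimanAnchorRungCMR_twelve` the day `stub_exchange_d12` lands.

References: [BuchweitzFlenner2003 = arXiv:math/9912245] Def. 4.1, Cor. 4.8, §5 (I-semiregular), Thm. 5.1;
[Markman2025SurveySecant = arXiv:2509.23403] §3, Lemma 11.3, §11.5; [vanGeemen1994HodgeAV] 4.14, Lemma 5.2, 5.3–5.4;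
[Landherr1936HermitianForms]; Green–Lazarsfeld, JAMS 4 (1991) (derivative complex — the language of the T-sieve); Mukai
1981 ∕ Pareschi–Popa, AJM 133 (2011) (IT₀ ∕ GV — the language of the VISIBILITY row).
-/

set_option linter.dupNamespace false

noncomputable section

open CategoryTheory CategoryTheory.Limits AlgebraicGeometry
open Literature.AlgebraicGeometry Literature.AlgebraicGeometry.Modules
open Literature.AlgebraicGeometry.Motives
open Literature.AlgebraicGeometry.HodgeTheory
open Literature.AlgebraicGeometry.VanGeemen1994
open Summit.HodgeConjecture.HodgeConjecture.Ring2.AbelianAll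

namespace Summit.HodgeConjecture.HodgeConjecture.Cruxes.TwistNormalisedKleimanSemiregularAnchorR.FibreExchangeClasses

/-! ### §0 The transfer of `I`-semiregularity along a chain map (central-character-transfer, σ-side; PROVED) -/

section Transfer

universe w₁ u₁

variable {S : Type u₁} [CommRing S] (X : Over (Spec (CommRingCat.of S))) [HasDerivedCategory.{w₁} X.left.Modules]
  {K K' : CochainComplex X.left.Modules ℤ}

/-- **Pull-back of a cross class along `φ` in the source**: `φ^* y := Q φ · y ∈ Ext²(K•, K•)` for
`y : Q K'• ⟶ (Q K•)⟦2⟧` (for `φ` lifting `E′ ↪ F`: the restriction of a class of `Ext²(F, E′)` to `Ext²(E′, E′)`).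
[cite: BuchweitzFlenner2003, §4 (paragraph before Cor. 4.8)] -/
def pullCross (φ : K ⟶ K')
    (y : ShiftedHom (DerivedCategory.Q.obj K') (DerivedCategory.Q.obj K) (2 : ℤ)) :
    ShiftedHom (DerivedCategory.Q.obj K) (DerivedCategory.Q.obj K) (2 : ℤ) :=
  (ShiftedHom.mk₀ (0 : ℤ) rfl (DerivedCategory.Q.map φ)).comp y (add_zero 2)

/-- **Push-forward of a cross class along `φ` in the target**: `φ_* y := y · Q φ ∈ Ext²(K'•, K'•)`.
[cite: BuchweitzFlenner2003, §4 (paragraph before Cor. 4.8)] -/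
def pushCross (φ : K ⟶ K')
    (y : ShiftedHom (DerivedCategory.Q.obj K') (DerivedCategory.Q.obj K) (2 : ℤ)) :
    ShiftedHom (DerivedCategory.Q.obj K') (DerivedCategory.Q.obj K') (2 : ℤ) :=
  y.comp (ShiftedHom.mk₀ (0 : ℤ) rfl (DerivedCategory.Q.map φ)) (zero_add 2)

variable (a b : ℤ) [K.IsStrictlyGE a] [K.IsStrictlyLE b] [K'.IsStrictlyGE a] [K'.IsStrictlyLE b]
  (hK : ∀ p, IsFiniteLocallyFree (K.X p)) (hK' : ∀ p, IsFiniteLocallyFree (K'.X p))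

/-- **LOCALITY row (σ-side)** for `φ : K• ⟶ K'•` and a set `I` of form degrees: every class of `Ext²(K•, K•)` killed by
all `σ_q`, `q ∈ I`, is a pull-back `φ^* y` of a cross class `y ∈ Ext²(K'•, K•)` («what `At(E′)` sees beyond `At(E♯)` is
fibre-local, and the demand on it is only for σ-invisible classes» — card `central-character-transfer`, K1, transposed to
the `σ`-side). [cite: BuchweitzFlenner2003, Cor. 4.8] -/
def SigmaLocality (φ : K ⟶ K') (I : Set ℕ) : Prop :=
  ∀ x : ShiftedHom (DerivedCategory.Q.obj K) (DerivedCategory.Q.obj K) (2 : ℤ),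
    (∀ q ∈ I, HomComplex.sigmaC X K a b hK q x = 0) →
      ∃ y : ShiftedHom (DerivedCategory.Q.obj K') (DerivedCategory.Q.obj K) (2 : ℤ), pullCross X φ y = x

/-- **Flat VISIBILITY row**: a cross class invisible on `K'•` (`φ_* y = 0`) restricts to zero on `K•` (`φ^* y = 0`);
implied by injectivity of `φ_*` on `Ext²(K'•, K•)`, i.e. by `Ext¹(F, F∕E′) = 0` (card `central-character-transfer`, K2,
an IT₀-type vanishing). [cite: BuchweitzFlenner2003, Cor. 4.8] -/
def VisibilityFlat (φ : K ⟶ K') : Prop :=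
  ∀ y : ShiftedHom (DerivedCategory.Q.obj K') (DerivedCategory.Q.obj K) (2 : ℤ),
    pushCross X φ y = 0 → pullCross X φ y = 0

/-- Dinaturality in the `pullCross`∕`pushCross` vocabulary: `σ_q^{K}(φ^* y) = σ_q^{K'}(φ_* y)`.
[cite: BuchweitzFlenner2003, Cor. 4.8] -/
theorem sigmaC_pullCross (φ : K ⟶ K') (q : ℕ)
    (y : ShiftedHom (DerivedCategory.Q.obj K') (DerivedCategory.Q.obj K) (2 : ℤ)) :
    HomComplex.sigmaC X K a b hK q (pullCross X φ y) = HomComplex.sigmaC X K' a b hK' q (pushCross X φ y) :=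
  HomComplex.sigmaC_dinatural X a b hK hK' φ q y

/-- **THE TRANSFER LEMMA (central-character-transfer, σ-side, sharp form; PROVED).** If `K'•` is `I`-semiregular and
`φ : K• ⟶ K'•` satisfies LOCALITY and flat VISIBILITY, then `K•` is `I`-semiregular: for `x ∈ ker σ_I^{K}`, write
`x = φ^* y` (locality); `σ_q^{K'}(φ_* y) = σ_q^{K}(x) = 0` for `q ∈ I` (dinaturality), so `φ_* y = 0` (`K'•`
semiregular), so `x = φ^* y = 0` (visibility). No surjectivity of `φ^*` is used (that version is dead: LEMMA S∕J, B2′).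
[cite: BuchweitzFlenner2003, Cor. 4.8 and §5 (I-semiregular)] -/
theorem isISemiregularC_of_locality_of_visibility (φ : K ⟶ K') (I : Set ℕ)
    (hF : HomComplex.IsISemiregularC X K' a b hK' I) (hloc : SigmaLocality X a b hK φ I)
    (hvis : VisibilityFlat X φ) : HomComplex.IsISemiregularC X K a b hK I := by
  rw [HomComplex.isISemiregularC_iff_ker] at hF ⊢
  intro x hx
  obtain ⟨y, rfl⟩ := hloc x hx
  refine hvis y (hF _ fun q hq => ?_)
  rw [← sigmaC_pullCross X a b hK hK' φ q y]
  exact hx q hq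

end Transfer


/-! ### §1 VERBATIM COPIES of `Lines/chosen_anchor.lean` §0–§1 (statements + pointwise Landherr; the module is not yet built
on the farm, so it cannot be imported — same device as `Lines/lagrangian_half_descent_anchor.lean` §0) -/

/-- **The REPAIRED seed predicate — a Buchweitz–Flenner COHERENT seed at the anchor `(P, h, w)` for `C`** (W1): an index
set `I ∋ 3`, an `𝒪_P`-module `E₀` GIVEN WITH a strictly perfect resolution `R`, rationals `q`, `N ≠ 0`, `c`, such that
`(σ_q)_{q+1 ∈ I}` is jointly injective on `Hom_{D(P)}(R.P, R.P[2]) = Ext²(E₀,E₀)` in some window `[b, 0]`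
(`HomComplex.IsISemiregularC`, Mathlib's standard derived category), `ch₃(R.P) = q·h³ + N·w` and `chₚ(R.P) = cₚ·hᵖ`
(`p ∈ I ∖ {3}`) for the Chern character `chPerfect C P.X R.P`. VERBATIM the seed binders of the refereed fact
`BuchweitzFlenner2003_variationalHodge_ISemiregular_coherent`; on `P.X` itself (no model quantifier: the fact takes the
model isomorphism in its own binders). [cite: BuchweitzFlenner2003, Def. 4.1, §5 (I-semiregular) and Thm. 5.1] -/
def HasBFCoherentSeedAt (C : ChernCharacterBetti) (P : AbelianVariety ℂ) (h : complexBetti P.X 2)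
    (w : complexBetti P.X (2 * 3)) : Prop :=
  ∃ (I : Finset ℕ) (E₀ : P.X.left.Modules) (R : StrictlyPerfectResolution E₀) (q N : ℚ) (c : ℕ → ℚ),
    3 ∈ I ∧ N ≠ 0 ∧
    (∃ (b : ℤ) (_ : R.P.IsStrictlyGE b), letI := HasDerivedCategory.standard P.X.left.Modules;
      HomComplex.IsISemiregularC P.X R.P b 0 R.isBoundedVB.isFiniteLocallyFree {q' | q' + 1 ∈ I}) ∧
    chPerfect C P.X R.P R.isBoundedVB.isFiniteLocallyFree 3 = ((q : ℚ) : ℂ) • cupPowTwo h 3 + ((N : ℚ) : ℂ) • w ∧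
    ∀ p' ∈ I, p' ≠ 3 → chPerfect C P.X R.P R.isBoundedVB.isFiniteLocallyFree p' = ((c p' : ℚ) : ℂ) • cupPowTwo h p'

/-- **K2ᵀᴿ at one `(C, d)`** (member-wise body, VERBATIM the repaired route decl under its binders): every non-hyperbolic
`√−d` Weil sixfold member carrying a non-zero Hodge Weil class has a doubly-polarised anchor Weil-similar to it at which
class designs upgrade to COHERENT Buchweitz–Flenner seeds. [cite: BuchweitzFlenner2003, §5 Thm. 5.1] -/
def MemberwiseAtR (C : ChernCharacterBetti) (d : ℕ) : Prop :=
  ∀ (A : AbelianVariety ℂ) (φ : A ⟶ A), A.dim = 2 * 3 → φ ≫ φ = -(d • 𝟙 A) →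
    (∀ (e : ProjectiveEmbedding A.X) (a : complexBetti (projectiveSpace e.n ℂ) 2), IsRationalClass a → a ≠ 0 →
      ¬ IsHyperbolicWeilType A φ 3
        ((d : ℂ) • complexBetti.map e.ι 2 a + complexBetti.map φ.hom.hom.hom 2 (complexBetti.map e.ι 2 a))) →
    (∃ wA : complexBetti A.X (2 * 3), wA ∈ weilClassesOf A φ 3 d ∧ wA ≠ 0 ∧
      IsOfHodgeType (2 * 3) A.X (2 * 3) 3 3 wA) →
    ∃ (eA : ProjectiveEmbedding A.X) (aA : complexBetti (projectiveSpace eA.n ℂ) 2) (P : AbelianVariety ℂ)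
      (ψ₀ : P ⟶ P) (e e' : ProjectiveEmbedding P.X) (a : complexBetti (projectiveSpace e.n ℂ) 2)
      (a' : complexBetti (projectiveSpace e'.n ℂ) 2) (w : complexBetti P.X (2 * 3)),
      IsRationalClass aA ∧ aA ≠ 0 ∧ P.dim = 2 * 3 ∧ ψ₀ ≫ ψ₀ = -(d • 𝟙 P) ∧ IsRationalClass a ∧ a ≠ 0 ∧
      IsRationalClass a' ∧ a' ≠ 0 ∧ w ∈ weilClassesOf P ψ₀ 3 d ∧ IsRationalClass w ∧ w ≠ 0 ∧
      IsOfHodgeType (2 * 3) P.X (2 * 3) 3 3 w ∧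
      IsHyperbolicWeilType P ψ₀ 3 ((d : ℂ) • complexBetti.map e'.ι 2 a' + complexBetti.map ψ₀.hom.hom.hom 2 (complexBetti.map e'.ι 2 a')) ∧
      ¬ IsHyperbolicWeilType P ψ₀ 3 ((d : ℂ) • complexBetti.map e.ι 2 a + complexBetti.map ψ₀.hom.hom.hom 2 (complexBetti.map e.ι 2 a)) ∧
      (HasWeilClassDesignAt C 3 P ((d : ℂ) • complexBetti.map e.ι 2 a + complexBetti.map ψ₀.hom.hom.hom 2 (complexBetti.map e.ι 2 a)) w → HasBFCoherentSeedAt C P ((d : ℂ) • complexBetti.map e.ι 2 a + complexBetti.map ψ₀.hom.hom.hom 2 (complexBetti.map e.ι 2 a)) w) ∧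
      IsWeilSimilar 3 P ψ₀ ((d : ℂ) • complexBetti.map e.ι 2 a + complexBetti.map ψ₀.hom.hom.hom 2 (complexBetti.map e.ι 2 a)) A φ ((d : ℂ) • complexBetti.map eA.ι 2 aA + complexBetti.map φ.hom.hom.hom 2 (complexBetti.map eA.ι 2 aA))

/-- Guard: the repaired route decl K2ᵀᴿ is LITERALLY `∀ C, twist-normalised → Kleiman → ∀ d > 0, MemberwiseAtR C d`
(`Iff.rfl`). [folklore] -/
theorem twistNormalisedKleimanSemiregularAnchorR_iff :
    Summit.HodgeConjecture.HodgeConjecture.Theses.KleimanBFSeeds.TwistNormalisedKleimanSemiregularAnchorR ↔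
      ∀ C : ChernCharacterBetti, C.IsTwistNormalised → C.KleimanChernNormalForm → ∀ d : ℕ, 0 < d →
        MemberwiseAtR C d :=
  Iff.rfl

/-- **One good anchor in the cell `δ`** (for `C`, `d`), repaired upgrade clause: a `(3, d)` anchor with a
non-degenerate discriminant witness of class `δ` at `h(e, a)`, hyperbolic at `h(e′, a′)`, `w` a non-zero rational `(3,3)`
Weil class, AT WHICH every class-level design upgrades to a COHERENT BF seed. [cite: vanGeemen1994HodgeAV, 4.14 and Lemma 5.2] -/
def GoodAnchorInCellAtR (C : ChernCharacterBetti) (d : ℕ) (δ : weilNormResidueGroup d) : Prop :=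
  ∃ (P : AbelianVariety ℂ) (ψ₀ : P ⟶ P) (e e' : ProjectiveEmbedding P.X)
    (a : complexBetti (projectiveSpace e.n ℂ) 2) (a' : complexBetti (projectiveSpace e'.n ℂ) 2)
    (w : complexBetti P.X (2 * 3)),
    P.dim = 2 * 3 ∧ ψ₀ ≫ ψ₀ = -(d • 𝟙 P) ∧ IsRationalClass a ∧ a ≠ 0 ∧ IsRationalClass a' ∧ a' ≠ 0 ∧
    w ∈ weilClassesOf P ψ₀ 3 d ∧ IsRationalClass w ∧ w ≠ 0 ∧ IsOfHodgeType (2 * 3) P.X (2 * 3) 3 3 w ∧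
    IsHyperbolicWeilType P ψ₀ 3 ((d : ℂ) • complexBetti.map e'.ι 2 a' + complexBetti.map ψ₀.hom.hom.hom 2 (complexBetti.map e'.ι 2 a')) ∧
    HasWeilDiscriminantNondeg P ψ₀ 3 d ((d : ℂ) • complexBetti.map e.ι 2 a + complexBetti.map ψ₀.hom.hom.hom 2 (complexBetti.map e.ι 2 a)) δ ∧
    (HasWeilClassDesignAt C 3 P ((d : ℂ) • complexBetti.map e.ι 2 a + complexBetti.map ψ₀.hom.hom.hom 2 (complexBetti.map e.ι 2 a)) w → HasBFCoherentSeedAt C P ((d : ℂ) • complexBetti.map e.ι 2 a + complexBetti.map ψ₀.hom.hom.hom 2 (complexBetti.map e.ι 2 a)) w)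

/-- **One good anchor per non-split cell** (for `C`, `d`). [cite: vanGeemen1994HodgeAV, 5.3–5.4] [cite: Landherr1936HermitianForms] -/
def GoodAnchorPerClassAtR (C : ChernCharacterBetti) (d : ℕ) : Prop :=
  ∀ δ : weilNormResidueGroup d, weilSign d δ = (-1) ^ 3 → δ ≠ QuotientGroup.mk ((-1 : ℚˣ) ^ 3) →
    GoodAnchorInCellAtR C d δ

/-- **Registered signature of `stub_good`** (the ∃-core of K2ᵀᴿ): for every twist-normalised Kleiman `C`, every `d ≥ 1`
and every non-split cell, one good anchor (repaired upgrade clause). [cite: BuchweitzFlenner2003, §5 Thm. 5.1]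
[cite: vanGeemen1994HodgeAV, 5.3–5.4] -/
def GoodAnchorPerDiscriminantClassR : Prop :=
  ∀ C : ChernCharacterBetti, C.IsTwistNormalised → C.KleimanChernNormalForm → ∀ d : ℕ, 0 < d →
    GoodAnchorPerClassAtR C d

/-- **THE RUNG `KleimanAnchorRungCMR d`**: K2ᵀᴿ RESTRICTED TO THE DISCRIMINANT `d` (members = the non-hyperbolic `√−d`
Weil sixfolds, each Weil-similar by X2 + Landherr to the CM anchor `(E₀³ × Ē₀³, h_b)`, `b ∉ Nm ℚ(√−d)ˣ`, of its cell).
`d = 3` is the first rung `stub_rung_CMclass_d3`. [cite: vanGeemen1994HodgeAV, 5.3–5.4] [cite: BuchweitzFlenner2003, §5 Thm. 5.1] -/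
def KleimanAnchorRungCMR (d : ℕ) : Prop :=
  ∀ C : ChernCharacterBetti, C.IsTwistNormalised → C.KleimanChernNormalForm → 0 < d → MemberwiseAtR C d

/-- **`GoodAnchorPerClassAtR C d → MemberwiseAtR C d`** (`0 < d`): verbatim the K2ᵀ proof
(`ChosenAnchor.memberwiseAt_of_goodAnchorPerClassAt`) — the member's own discriminant class `δ` has sign `(−1)³` and is
not split (else the member would be hyperbolic), the good anchor of class `δ` is not hyperbolic at `h(e,a)` and is
Weil-similar to the member by Landherr; the upgrade clause is passed through unopened.
[cite: vanGeemen1994HodgeAV, 4.14, Lemma 5.2 (1)–(4), 5.3–5.4] [cite: Landherr1936HermitianForms] -/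
theorem memberwiseAtR_of_goodAnchorPerClassAtR (C : ChernCharacterBetti) {d : ℕ} (hd : 0 < d)
    (hgood : GoodAnchorPerClassAtR C d) : MemberwiseAtR C d := by
  intro A φ hA hφ hns hwA
  obtain ⟨wA, hwA, hwA0, hwAH⟩ := hwA
  have n3 : (0 : ℕ) < 3 := by norm_num
  have hW' : IsWeilType A φ 3 d := isWeilType_of_weilClass_ne_zero n3 hd hA hφ hwA hwA0 hwAH
  obtain ⟨eA, aA, haA, haA0, -⟩ := exists_weightedSegreEmbedding_self_prod A
  obtain ⟨δ, hδA, hsign⟩ := exists_hasWeilDiscriminantNondeg_weilSign hW' eA haA haA0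
  have hne : δ ≠ QuotientGroup.mk ((-1 : ℚˣ) ^ 3) := by
    rintro rfl
    obtain ⟨-, e, a, ha, ha0, hh⟩ :=
      Literature.AlgebraicGeometry.VanGeemen1994.IsWeilType.isSplitWeilType_of_hasWeilDiscriminantNondeg_split
        hW' eA haA haA0 hδA
    exact hns e a ha ha0 hh
  obtain ⟨P, ψ₀, e, e', a, a', w, hP, hψ, ha, ha0, ha', ha'0, hwW, hwrat, hw0, hwH, hhyp, hN, hup⟩ :=
    hgood δ hsign hne
  have hWP : IsWeilType P ψ₀ 3 d := isWeilType_of_weilClass_ne_zero n3 hd hP hψ hwW hw0 hwH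
  have hnot := not_isHyperbolicWeilType_of_hasWeilDiscriminantNondeg_ne n3 hP hd hψ e ha ha0 hN hne
  have hsim := isWeilSimilar_of_hasWeilDiscriminantNondeg hWP hW' e ha ha0 eA haA haA0 hN hδA
  exact ⟨eA, aA, P, ψ₀, e, e', a, a', w, haA, haA0, hP, hψ, ha, ha0, ha', ha'0, hwW, hwrat, hw0, hwH, hhyp,
    hnot, hup, hsim⟩

/-- The registered stub statement gives every rung. [cite: vanGeemen1994HodgeAV, 5.3–5.4] -/
theorem kleimanAnchorRungCMR_of_goodAnchorPerDiscriminantClassR (h : GoodAnchorPerDiscriminantClassR) (d : ℕ) :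
    KleimanAnchorRungCMR d :=
  fun C hT hK hd => memberwiseAtR_of_goodAnchorPerClassAtR C hd (h C hT hK d hd)

/-! ### §2 The statements of the line (d generic in the definitions; the stub is `d = 12`) -/

/-- **Anchor rows** of `ChosenAnchor.GoodAnchorInCellAtR C d δ` WITHOUT its upgrade clause (they do not mention `C`):
a `(3, d)` doubly-polarised anchor `P`, hyperbolic at `h(e′,a′)`, of discriminant class `δ` at `h(e,a)`, with a
non-zero rational `(3,3)` Weil class `w`. [cite: vanGeemen1994HodgeAV, 4.14 and Lemma 5.2] -/
def AnchorRows (d : ℕ) (δ : weilNormResidueGroup d) (P : AbelianVariety ℂ) (ψ₀ : P ⟶ P)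
    (e e' : ProjectiveEmbedding P.X) (a : complexBetti (projectiveSpace e.n ℂ) 2)
    (a' : complexBetti (projectiveSpace e'.n ℂ) 2) (w : complexBetti P.X (2 * 3)) : Prop :=
  P.dim = 2 * 3 ∧ ψ₀ ≫ ψ₀ = -(d • 𝟙 P) ∧ IsRationalClass a ∧ a ≠ 0 ∧ IsRationalClass a' ∧ a' ≠ 0 ∧
    w ∈ weilClassesOf P ψ₀ 3 d ∧ IsRationalClass w ∧ w ≠ 0 ∧ IsOfHodgeType (2 * 3) P.X (2 * 3) 3 3 w ∧
    IsHyperbolicWeilType P ψ₀ 3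
      ((d : ℂ) • complexBetti.map e'.ι 2 a' + complexBetti.map ψ₀.hom.hom.hom 2 (complexBetti.map e'.ι 2 a')) ∧
    HasWeilDiscriminantNondeg P ψ₀ 3 d
      ((d : ℂ) • complexBetti.map e.ι 2 a + complexBetti.map ψ₀.hom.hom.hom 2 (complexBetti.map e.ι 2 a)) δ

/-- **THE EXCHANGE SEED at `(P, h, h′, w)`** — the typed package of this line. Objects (C-independent): an input module
`F` (E♯) and a sub-object `E′`, both GIVEN WITH strictly perfect resolutions `R_F`, `R′` in a common window `[b, 0]`,
a chain map `φ : R′• ⟶ R_F•` (lifting `E′ → F`), an index set `I ∋ 3`. Rows: (INPUT) `F` is `{q | q+1 ∈ I}`-semiregular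
on `R_F•` (`HomComplex.IsISemiregularC`, Mathlib's standard derived category); (LOCALITY) `SigmaLocality φ`;
(VISIBILITY♭) `VisibilityFlat φ`; (FRAMES, for every twist-normalised Kleiman `C`) the input is read in the HYPERBOLIC
frame — `ch₃(R_F•) = q′h′³ + N′w`, `N′ ≠ 0`, `chₚ(R_F•) = c′ₚ h′ᵖ` on `I ∖ {3}` (Markman's secant seed) — and the
exchange is RE-FRAMED into the target frame — `ch₃(R′•) = q h³ + N w`, `N ≠ 0`, `chₚ(R′•) = cₚ hᵖ` on `I ∖ {3}`
(the R♮ ∕ repointing class identity). The frame rows on `F` are what exclude the degenerate witness `φ = 𝟙`.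
[cite: BuchweitzFlenner2003, Def. 4.1, §5 (I-semiregular)] [cite: Markman2025SurveySecant, §3 and Lemma 11.3] -/
def ExchangeSeedAt (P : AbelianVariety ℂ) (h h' : complexBetti P.X 2) (w : complexBetti P.X (2 * 3)) : Prop :=
  ∃ (F E' : P.X.left.Modules) (RF : StrictlyPerfectResolution F) (R' : StrictlyPerfectResolution E')
    (φ : R'.P ⟶ RF.P) (I : Finset ℕ) (b : ℤ) (_ : RF.P.IsStrictlyGE b) (_ : R'.P.IsStrictlyGE b),
    3 ∈ I ∧
    (letI := HasDerivedCategory.standard P.X.left.Modules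
     HomComplex.IsISemiregularC P.X RF.P b 0 RF.isBoundedVB.isFiniteLocallyFree {q' | q' + 1 ∈ I} ∧
       SigmaLocality P.X b 0 R'.isBoundedVB.isFiniteLocallyFree φ {q' | q' + 1 ∈ I} ∧
       VisibilityFlat P.X φ) ∧
    ∀ C : ChernCharacterBetti, C.IsTwistNormalised → C.KleimanChernNormalForm →
      (∃ (q' N' : ℚ) (c' : ℕ → ℚ), N' ≠ 0 ∧
        chPerfect C P.X RF.P RF.isBoundedVB.isFiniteLocallyFree 3 =
          ((q' : ℚ) : ℂ) • cupPowTwo h' 3 + ((N' : ℚ) : ℂ) • w ∧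
        ∀ p' ∈ I, p' ≠ 3 →
          chPerfect C P.X RF.P RF.isBoundedVB.isFiniteLocallyFree p' = ((c' p' : ℚ) : ℂ) • cupPowTwo h' p') ∧
      (∃ (q N : ℚ) (c : ℕ → ℚ), N ≠ 0 ∧
        chPerfect C P.X R'.P R'.isBoundedVB.isFiniteLocallyFree 3 =
          ((q : ℚ) : ℂ) • cupPowTwo h 3 + ((N : ℚ) : ℂ) • w ∧
        ∀ p' ∈ I, p' ≠ 3 →
          chPerfect C P.X R'.P R'.isBoundedVB.isFiniteLocallyFree p' = ((c p' : ℚ) : ℂ) • cupPowTwo h p')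

/-- **One exchange package in the cell `δ`** (for `d`): anchor rows + the exchange seed at
`(P, h(e,a), h(e′,a′), w)`. [cite: vanGeemen1994HodgeAV, 5.3–5.4] [cite: Markman2025SurveySecant, §11.5] -/
def ExchangePackageInCell (d : ℕ) (δ : weilNormResidueGroup d) : Prop :=
  ∃ (P : AbelianVariety ℂ) (ψ₀ : P ⟶ P) (e e' : ProjectiveEmbedding P.X)
    (a : complexBetti (projectiveSpace e.n ℂ) 2) (a' : complexBetti (projectiveSpace e'.n ℂ) 2)
    (w : complexBetti P.X (2 * 3)),
    AnchorRows d δ P ψ₀ e e' a a' w ∧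
    ExchangeSeedAt P
      ((d : ℂ) • complexBetti.map e.ι 2 a + complexBetti.map ψ₀.hom.hom.hom 2 (complexBetti.map e.ι 2 a))
      ((d : ℂ) • complexBetti.map e'.ι 2 a' + complexBetti.map ψ₀.hom.hom.hom 2 (complexBetti.map e'.ι 2 a'))
      w

/-! ### §3 PROVED reductions: exchange seed ⟹ coherent BF seed ⟹ good anchor in the cell ⟹ the `d`-rung -/

/-- **An exchange seed at `(P, h, h′, w)` is a COHERENT BF SEED at `(P, h, w)` for every twist-normalised Kleiman `C`**
(the repaired seed predicate `ChosenAnchor.HasBFCoherentSeedAt`, VERBATIM the seed binders of the refereed fact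
`BuchweitzFlenner2003_variationalHodge_ISemiregular_coherent`): the seed is `E′` on its resolution `R′•`, its
`I`-semiregularity is TRANSFERRED from `F` (`isISemiregularC_of_locality_of_visibility`), its Chern rows are the
re-framed ones. [cite: BuchweitzFlenner2003, §5 Thm. 5.1] -/
theorem hasBFCoherentSeedAt_of_exchangeSeedAt (C : ChernCharacterBetti) (hT : C.IsTwistNormalised)
    (hK : C.KleimanChernNormalForm) (P : AbelianVariety ℂ) (h h' : complexBetti P.X 2)
    (w : complexBetti P.X (2 * 3)) (hS : ExchangeSeedAt P h h' w) : HasBFCoherentSeedAt C P h w := by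
  obtain ⟨F, E', RF, R', φ, I, b, hbF, hb', h3I, ⟨hF, hloc, hvis⟩, hcls⟩ := hS
  obtain ⟨-, q, N, c, hN, hch3, hchp⟩ := hcls C hT hK
  letI := HasDerivedCategory.standard P.X.left.Modules
  exact ⟨I, E', R', q, N, c, h3I, hN,
    ⟨b, hb', isISemiregularC_of_locality_of_visibility P.X b 0 R'.isBoundedVB.isFiniteLocallyFree
      RF.isBoundedVB.isFiniteLocallyFree φ _ hF hloc hvis⟩, hch3, hchp⟩

/-- **An exchange package in the cell `δ` is a good anchor in the cell `δ`** (`ChosenAnchor.GoodAnchorInCellAtR C d δ`)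
for every twist-normalised Kleiman `C`: the upgrade clause `HasWeilClassDesignAt … → HasBFCoherentSeedAt …` is
discharged OUTRIGHT (the design hypothesis is not used). [cite: BuchweitzFlenner2003, §5 Thm. 5.1]
[cite: vanGeemen1994HodgeAV, 4.14 and Lemma 5.2] -/
theorem goodAnchorInCellAtR_of_exchangePackageInCell (C : ChernCharacterBetti) (hT : C.IsTwistNormalised)
    (hK : C.KleimanChernNormalForm) {d : ℕ} (δ : weilNormResidueGroup d) (hP : ExchangePackageInCell d δ) :
    GoodAnchorInCellAtR C d δ := by
  obtain ⟨P, ψ₀, e, e', a, a', w, ⟨hPd, hψ, ha, ha0, ha', ha'0, hwW, hwr, hw0, hwH, hhyp, hN⟩, hseed⟩ := hP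
  exact ⟨P, ψ₀, e, e', a, a', w, hPd, hψ, ha, ha0, ha', ha'0, hwW, hwr, hw0, hwH, hhyp, hN,
    fun _ => hasBFCoherentSeedAt_of_exchangeSeedAt C hT hK P _ _ w hseed⟩

/-- **Exchange packages in every non-split cell give the `d`-rung** (`ChosenAnchor.KleimanAnchorRungCMR d`) by the
PROVED pointwise-Landherr reduction `ChosenAnchor.memberwiseAtR_of_goodAnchorPerClassAtR` of the registered skeleton.
[cite: vanGeemen1994HodgeAV, 5.3–5.4] [cite: Landherr1936HermitianForms] -/
theorem kleimanAnchorRungCMR_of_exchangePackages {d : ℕ}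
    (hex : ∀ δ : weilNormResidueGroup d, weilSign d δ = (-1) ^ 3 → δ ≠ QuotientGroup.mk ((-1 : ℚˣ) ^ 3) →
      ExchangePackageInCell d δ) :
    KleimanAnchorRungCMR d :=
  fun C hT hK hd => memberwiseAtR_of_goodAnchorPerClassAtR C hd
    fun δ hs hne => goodAnchorInCellAtR_of_exchangePackageInCell C hT hK δ (hex δ hs hne)

/-! ### §4 The stubs (SIX `sorry`s: one of this line at NATIVE `d = 12`, two carried verbatim from the sibling `d = 3` line, three chosen-anchor records) -/

/-- **STUB `stub_exchange_d12`** (NEW; LOAD-BEARING for this line; registered signature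
`∀ δ : weilNormResidueGroup 12, weilSign 12 δ = (-1) ^ 3 → δ ≠ QuotientGroup.mk ((-1 : ℚˣ) ^ 3) → ExchangePackageInCell 12 δ`).
For every non-split cell `δ` of the NATIVE secant discriminant `d = 12` (`ψ₀² = −12`, `η(K) ∩ End = ℤ[2√−3]` on every
secant member): an exchange package — a doubly-polarised anchor `P` of class `δ` at `h`, hyperbolic at `h′` (an
isotrivially-fibred secant NL-member `P → E`, fibres translates of an abelian fivefold `Y`), carrying Markman's secant
seed E♯ read in the frame `h′` and a parallel-fibre elementary transform `E′ = ker(E♯ → ⊕ⱼ ι_{tⱼ *} Qⱼ)` re-framed into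
`ℚ[h] ⊕ ℚ·w`, with LOCALITY and flat VISIBILITY for `φ : R′• ⟶ R_{E♯}•`. WHY PLAUSIBLY TRUE: E♯ is semiregular on the
hyperbolic cell (Markman, Lemma 11.3: `HT²`-surjectivity) and C-evaluable (LEMMA U, `IsTwistNormalised`); the class
re-framing is the repointing identity (p822849) with `(b−1)` fibres; VISIBILITY♭ ⟸ `Ext¹(E♯, ι_*Q) = H¹(Y, 𝓗om(E♯_Y, Q)) = 0`
(IT₀ for a positive bundle); LOCALITY is the one open cohomology table on the fivefold, with the T-SIEVE
`α ∪ ε = 0 ∈ Ext²_Y(Q₁, K) ∀ α ∈ H¹(Y, 𝒪_Y)` as its necessary condition (AJ-statics of fibre exchanges). WHY IT MIGHT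
FAIL: semiregularity of E♯ may fail on the whole doubly-polarised (NL ∕ product) locus (`Ext²` jumps at reducible
members, CENSUS-5 (R3)); `T` may fail on the forced `Quot` component (then every parallel-fibre design with ≥ 3 fibres is
non-semiregular — the card's kill); the only admissible packages may be `t`-rigid. Size XL (one construction + one
cohomology table on an abelian fivefold + one IT₀ vanishing, uniform in `δ` by the fibre count).
[cite: Markman2025SurveySecant, §3, Lemma 11.3 and §11.5] [cite: BuchweitzFlenner2003, Cor. 4.8 and §5 Thm. 5.1]
[cite: vanGeemen1994HodgeAV, 5.3–5.4] -/
theorem stub_exchange_d12 : ∀ δ : weilNormResidueGroup 12, weilSign 12 δ = (-1) ^ 3 →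
    δ ≠ QuotientGroup.mk ((-1 : ℚˣ) ^ 3) → ExchangePackageInCell 12 δ := by
  sorry

/-! #### §4b The sibling line's `d = 3` records, CARRIED VERBATIM (definitions + the two stubs, from
`Lines/lagrangian_half_descent_anchor.lean` §1 and §3, sha 14179b62164a; NOT in the cone of anything proved here; kept so that
registering this skeleton does not expire them — one active skeleton record per crux) -/

/-- The doubly-polarised class `h(e, a) := d·e^*a + ψ₀^*(e^*a) ∈ H²(P; ℂ)` of the crux's binders (reducible
abbreviation; the §0 copies spell it out). [cite: vanGeemen1994HodgeAV, 4.14] -/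
abbrev hClass (P : AbelianVariety ℂ) (ψ₀ : P ⟶ P) (d : ℕ) (e : ProjectiveEmbedding P.X)
    (a : complexBetti (projectiveSpace e.n ℂ) 2) : complexBetti P.X 2 :=
  (d : ℂ) • complexBetti.map e.ι 2 a + complexBetti.map ψ₀.hom.hom.hom 2 (complexBetti.map e.ι 2 a)

/-- **A fibre direction** on the `√−d` member `(P, ψ₀)`: a non-zero rational `(1,1)`-class `θ` which is `ψ₀`-Hermitian
(`ψ₀^*θ = d·θ`, i.e. `H`-symmetric given `ψ₀² = −d`) and of cup-square zero — the class `θ♭` of the fibres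
`D_t = Y′ × {t}` of the projection of a PRODUCT-TYPE member onto its CM elliptic quotient (card K2: `A♭_C ⊃ Y′`,
elliptic quotient of type `(0,1)`; the parallel fibres of the R♮ modification). [cite: vanGeemen1994HodgeAV, 5.3–5.4]
[cite: Markman2025SurveySecant, §11.5] -/
def IsFibreDirection (P : AbelianVariety ℂ) (ψ₀ : P ⟶ P) (d : ℕ) (θ : complexBetti P.X 2) : Prop :=
  IsRationalClass θ ∧ θ ≠ 0 ∧ IsOfHodgeType (2 * 3) P.X 2 1 1 θ ∧
    complexBetti.map ψ₀.hom.hom.hom 2 θ = (d : ℂ) • θ ∧ cupPowTwo θ 2 = 0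

/-- **`HalfDescentInputAt C d` — THE INPUT** (card K1 ∧ K2 ∧ K3 as ONE typed ∃-statement; the member is typed as the `P`
of `HasWeilClassDesignAt C 3 P h w`, TRIAGE-r1-2 sharpening): there is a `√−d` Weil sixfold `(P, ψ₀)`, `ψ₀² = −d` NATIVELY
(at `d = 3`: `P = A♭_C = A ∕ (0 ⊕ X̂[2])`, `ψ₀ = η(√−12)∕2`, §4), with a hyperbolic doubly-polarised class `h′ = h(e′,a′)`
(the split cell), a non-zero rational `(3,3)` Weil class `w`, a fibre direction `θ` (`IsFibreDirection`), a COHERENT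
Buchweitz–Flenner seed for `(h′, w)` (at `d = 3`: the half-descended secant sheaf `E♭`, simple, untwisted, `c₁ = −8h₁♭`,
Kleiman normal form with the secant's `N ≠ 0`, totally semiregular at a Zariski-general `E_ω`-cover quartic — THEOREM ♭,
THEOREM T, PROPOSITION A), and, for EVERY non-split cell `δ` of sign `(−1)³`, a doubly-polarised class
`h(e,a) = λ·h′ + f·θ` in the pencil spanned by `h′` and `θ` whose discriminant is non-degenerate of class `δ` (card K2:
`β ↦ disc(h_{Y′} + β θ₆)` runs through `ℚˣ ∕ Nm ℚ(√−d)ˣ`; PROPOSITION A §3.4 (iii)). Why it might fail: the cell map of K2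
is a Hermitian-determinant computation done abstractly for `Y × E_ω` only (U); Markman-goodness is Zariski-open but not
known at a NAMED curve (ALPHA-SCOPE §D); reading `E♭`'s classes through an abstract `C` needs LEMMA U (req-198). Size L.
[cite: Markman2025SurveySecant, §11 p. 17, Prop. 11.1 and Prop. 11.5] [cite: BuchweitzFlenner2003, §5 Thm. 5.1]
[cite: vanGeemen1994HodgeAV, 5.3–5.4] -/
def HalfDescentInputAt (C : ChernCharacterBetti) (d : ℕ) : Prop :=
  ∃ (P : AbelianVariety ℂ) (ψ₀ : P ⟶ P) (e' : ProjectiveEmbedding P.X)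
    (a' : complexBetti (projectiveSpace e'.n ℂ) 2) (w : complexBetti P.X (2 * 3)) (θ : complexBetti P.X 2),
    P.dim = 2 * 3 ∧ ψ₀ ≫ ψ₀ = -(d • 𝟙 P) ∧ IsRationalClass a' ∧ a' ≠ 0 ∧
    IsHyperbolicWeilType P ψ₀ 3 (hClass P ψ₀ d e' a') ∧
    w ∈ weilClassesOf P ψ₀ 3 d ∧ IsRationalClass w ∧ w ≠ 0 ∧ IsOfHodgeType (2 * 3) P.X (2 * 3) 3 3 w ∧
    IsFibreDirection P ψ₀ d θ ∧
    HasBFCoherentSeedAt C P (hClass P ψ₀ d e' a') w ∧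
    ∀ δ : weilNormResidueGroup d, weilSign d δ = (-1) ^ 3 → δ ≠ QuotientGroup.mk ((-1 : ℚˣ) ^ 3) →
      ∃ (e : ProjectiveEmbedding P.X) (a : complexBetti (projectiveSpace e.n ℂ) 2) (lam f : ℚ),
        IsRationalClass a ∧ a ≠ 0 ∧
        hClass P ψ₀ d e a = ((lam : ℚ) : ℂ) • hClass P ψ₀ d e' a' + ((f : ℚ) : ℂ) • θ ∧
        HasWeilDiscriminantNondeg P ψ₀ 3 d (hClass P ψ₀ d e a) δ

/-- **`FibreTransferAt C d` — THE TRANSFER** (the σ-row, rows (1½b′)+(1½c); the hard core, shared with the companion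
lines `fibre-exchange-classes` ∕ `central-character-transfer`): on a `√−d` member carrying a hyperbolic class `h′`, a
non-zero rational `(3,3)` Weil class `w`, a fibre direction `θ` and a COHERENT BF seed for `(h′, w)`, every doubly-polarised
class `h(e,a) = λ·h′ + f·θ` of the pencil with a non-degenerate NON-SPLIT discriminant at which a class-level design
exists carries a COHERENT BF seed for `(h(e,a), w)` — the elementary modification of the input along `b − 1` parallel
fibres `D_{t_j}` (class `θ`) by rank-8 quotient packages, `c₁ ↦ c₁ − 8(b−1)θ`, re-normalised at `h(e,a)` (R♮; F1 memo
5-equation solve with free parameters; LEMMA K packages in dual Picard blocks), with `σ` still injective on `Ext²` of the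
modified object. Why it might fail: THEOREM F ∕ LEMMA H ∕ ADD3 (F-ns) show the input's own `σ`-image seeds the split cell
only and B2′ v2 shows `im σ_{E′} ⊄ im σ_E` (excess 34), LEMMA S∕J give `Ext²_D(Q, E′_D) ⊇ ℂ¹⁰` trace-free — semiregularity
of the modified object must come from a NEW mechanism (central-character transfer ∕ T-sieve), none in print; LS₄-c forces
rank ≥ 5 or a non-locally-free seed. Size XL (open). [cite: BuchweitzFlenner2003, Def. 4.1 and §5 Thm. 5.1]
[cite: Markman2025SurveySecant, Lemma 11.3 and Question 11.4] [cite: vanGeemen1994HodgeAV, 5.3–5.4] -/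
def FibreTransferAt (C : ChernCharacterBetti) (d : ℕ) : Prop :=
  ∀ (P : AbelianVariety ℂ) (ψ₀ : P ⟶ P) (e' : ProjectiveEmbedding P.X)
    (a' : complexBetti (projectiveSpace e'.n ℂ) 2) (w : complexBetti P.X (2 * 3)) (θ : complexBetti P.X 2),
    P.dim = 2 * 3 → ψ₀ ≫ ψ₀ = -(d • 𝟙 P) → IsRationalClass a' → a' ≠ 0 →
    IsHyperbolicWeilType P ψ₀ 3 (hClass P ψ₀ d e' a') →
    w ∈ weilClassesOf P ψ₀ 3 d → IsRationalClass w → w ≠ 0 → IsOfHodgeType (2 * 3) P.X (2 * 3) 3 3 w →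
    IsFibreDirection P ψ₀ d θ →
    HasBFCoherentSeedAt C P (hClass P ψ₀ d e' a') w →
    ∀ (e : ProjectiveEmbedding P.X) (a : complexBetti (projectiveSpace e.n ℂ) 2) (lam f : ℚ)
      (δ : weilNormResidueGroup d),
      IsRationalClass a → a ≠ 0 →
      hClass P ψ₀ d e a = ((lam : ℚ) : ℂ) • hClass P ψ₀ d e' a' + ((f : ℚ) : ℂ) • θ →
      weilSign d δ = (-1) ^ 3 → δ ≠ QuotientGroup.mk ((-1 : ℚˣ) ^ 3) →
      HasWeilDiscriminantNondeg P ψ₀ 3 d (hClass P ψ₀ d e a) δ →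
      HasWeilClassDesignAt C 3 P (hClass P ψ₀ d e a) w → HasBFCoherentSeedAt C P (hClass P ψ₀ d e a) w

/-- **STUB `stub_halfDescentInput_d3`** (THIS LINE, NATIVE `d = 3`; card K1 ∧ K2 ∧ K3): for every twist-normalised Kleiman
`C`, the input at `d = 3` — the member `A♭_C = A ∕ (0 ⊕ X̂[2])` of a Zariski-general `E_ω`-cover plane quartic `C` with
`ψ₀ = η(√−12)∕2`, `ψ₀² = −3` (§4), its hyperbolic class `h₁♭`, Weil class `w♭`, fibre direction `θ♭`, the half-descended
secant sheaf `E♭` as a COHERENT BF seed at `(h₁♭, w♭)` (THEOREM ♭ (i)(ii) + THEOREM T ∕ CENSUS-6 (R4)(a) for the 63 pure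
twists of `ker ĝ` + Markman Prop. 11.5 at a Markman-good curve, PROPOSITION A), and pencil classes `λ h₁♭ + f θ♭` in every
non-split `ℚ(√−3)` cell (card K2, PROPOSITION A §3.4 (iii)). Why plausibly true: lattice bookkeeping (P, triage ×2), the
63 cross summands vanish pointwise (THEOREM T, pen ×2; ALPHA-SCOPE §A′), Markman-good `E_ω`-covers exist (LEMMA DENSE +
semicontinuity, pen (P)), THEOREM α (p822647) for the split type. Why it might fail: the cell map (U), `C`-evaluation of `E♭`
(LEMMA U, req-198), Markman-goodness only Zariski-generally on the cover locus (ALPHA-SCOPE §D). Size L.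
[cite: Markman2025SurveySecant, §11 p. 17, Prop. 11.1, Prop. 11.5] [cite: BuchweitzFlenner2003, §5 Thm. 5.1]
[cite: vanGeemen1994HodgeAV, 5.3–5.4] -/
theorem stub_halfDescentInput_d3 :
    ∀ C : ChernCharacterBetti, C.IsTwistNormalised → C.KleimanChernNormalForm → HalfDescentInputAt C 3 := by
  sorry

/-- **STUB `stub_fibreTransfer_d3`** (THIS LINE, NATIVE `d = 3`; HARDEST, the σ-row (1½b′)+(1½c) on `E♭`-type input): for
every twist-normalised Kleiman `C`, the transfer at `d = 3` — on a `√−3` member with hyperbolic `h′`, Weil class `w`, fibre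
direction `θ` and a coherent seed at `(h′, w)`, every designed pencil class `λ h′ + f θ` of non-split discriminant carries a
coherent BF seed for `(·, w)`. Mechanism foreseen: R♮ elementary modification of `E♭` along `b − 1` parallel fibres of class
`θ♭` by rank-8 packages (LEMMA K: subsheaves of dual Picard blocks), Kleiman re-normalisation at `h(e,a)` (F1 5-equation
solve), semiregularity of the modified sheaf by central-character transfer ∕ the fibre-exchange T-sieve (companion lines).
Why it might fail: THEOREM F ∕ LEMMA H (σ-image of `E♯`-type inputs seeds the split cell only), B2′ v2 (`im σ_{E′} ⊄ im σ_E`,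
excess 34), LEMMA S∕J (`Ext²_D(Q,E′_D) ⊇ ℂ¹⁰` trace-free), LS₄-c; no transfer theorem in print. Size XL (open).
[cite: BuchweitzFlenner2003, Def. 4.1 and §5 Thm. 5.1] [cite: Markman2025SurveySecant, Lemma 11.3 and Question 11.4] -/
theorem stub_fibreTransfer_d3 :
    ∀ C : ChernCharacterBetti, C.IsTwistNormalised → C.KleimanChernNormalForm → FibreTransferAt C 3 := by
  sorry

/-- **STUB `stub_good`** (registry record of `Lines/chosen_anchor.lean` v2.1, RE-DECLARED VERBATIM so this skeleton's
registration keeps it matched; LOAD-BEARING for the crux BY NAME): one good anchor per non-split cell, every `d ≥ 1`,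
every twist-normalised Kleiman `C`. Why it might fail ∕ sources: as in the registered skeleton.
[cite: BuchweitzFlenner2003, Def. 4.1 and §5 Thm. 5.1] [cite: vanGeemen1994HodgeAV, 5.3–5.4]
[cite: Markman2025SurveySecant, §3 and Lemma 11.3] -/
theorem stub_good : GoodAnchorPerDiscriminantClassR := by
  sorry

/-- **STUB `stub_rung_CMclass_d12`** (registry record, RE-DECLARED VERBATIM; T3 plan-only first-rung candidate,
registered signature `KleimanAnchorRungCMR 12`). THIS LINE DISCHARGES IT: `kleimanAnchorRungCMR_twelve` below proves
`KleimanAnchorRungCMR 12` with sorry-cone `stub_exchange_d12` only; the record is kept so that hands proving the rung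
by other means still match a registered stub. [cite: Markman2025SurveySecant, §11.5] [cite: BuchweitzFlenner2003, §5 Thm. 5.1] -/
theorem stub_rung_CMclass_d12 : KleimanAnchorRungCMR 12 := by
  sorry

/-- **STUB `stub_rung_CMclass_d3`** (registry record, RE-DECLARED VERBATIM; second rung, registered signature
`KleimanAnchorRungCMR 3`; the sibling line `Lines/lagrangian_half_descent_anchor.lean` works `d = 3` on E♭ and carries it too).
[cite: vanGeemen1994HodgeAV, 5.3–5.4] [cite: BuchweitzFlenner2003, §5 Thm. 5.1] -/
theorem stub_rung_CMclass_d3 : KleimanAnchorRungCMR 3 := by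
  sorry

/-! ### §5 Compositions (kernel-checked) -/

/-- **THE RUNG `d = 12` FROM THE EXCHANGE STUB** — literally the registered signature of `stub_rung_CMclass_d12`;
sorry-cone = `stub_exchange_d12` only (transfer lemma, seed plumbing and pointwise Landherr are PROVED).
[cite: BuchweitzFlenner2003, Cor. 4.8 and §5 Thm. 5.1] [cite: vanGeemen1994HodgeAV, 5.3–5.4] -/
theorem kleimanAnchorRungCMR_twelve : KleimanAnchorRungCMR 12 :=
  kleimanAnchorRungCMR_of_exchangePackages stub_exchange_d12

/-- **Composition concluding the crux BY NAME** (as in the registered skeleton; sorry-cone = `stub_good` only): pointwise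
Landherr (`memberwiseAtR_of_goodAnchorPerClassAtR`, PROVED, §1 verbatim copy of the chosen-anchor proof). The E♯ exchange line feeds the
`d = 12` instance of `stub_good`'s statement (`goodAnchorInCellAtR_of_exchangePackageInCell`), not all `d`.
[cite: vanGeemen1994HodgeAV, 4.14, Lemma 5.2, 5.3–5.4] [cite: Landherr1936HermitianForms] -/
theorem TwistNormalisedKleimanSemiregularAnchorR_of :
    Summit.HodgeConjecture.HodgeConjecture.Theses.KleimanBFSeeds.TwistNormalisedKleimanSemiregularAnchorR := by
  have hgood : GoodAnchorPerDiscriminantClassR := stub_good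
  intro C hT hK d hd
  exact memberwiseAtR_of_goodAnchorPerClassAtR C hd (hgood C hT hK d hd)

/-- Guard: the `d = 12` cells of `stub_good`'s statement are exactly what the exchange stub supplies.
[cite: vanGeemen1994HodgeAV, 5.3–5.4] -/
theorem goodAnchorPerClassAtR_twelve (C : ChernCharacterBetti) (hT : C.IsTwistNormalised)
    (hK : C.KleimanChernNormalForm) : GoodAnchorPerClassAtR C 12 :=
  fun δ hs hne => goodAnchorInCellAtR_of_exchangePackageInCell C hT hK δ (stub_exchange_d12 δ hs hne)

end Summit.HodgeConjecture.HodgeConjecture.Cruxes.TwistNormalisedKleimanSemiregularAnchorR.FibreExchangeClasses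

end
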